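import Mathlib
import HarnessLib

/-!
# Obstruction theory for perfect complexes across a first-order (square-zero) thickening

Layer `Literature/AlgebraicGeometry/Deformation`. For a **first-order thickening** of schemes
`i : Y₀ ⟶ Y₁` (a closed immersion whose ideal sheaf `𝓘 = Ker(i♯)` has square zero, so that `i`
is a homeomorphism and `𝓘` is an `𝒪_{Y₀}`-module) and a perfect complex `K₀` on `Y₀`, the
literature attaches an **obstruction class**
`ob(K₀) ∈ Ext²_{Y₀}(K₀, K₀ ⊗ᴸ 𝓘)` which vanishes iff `K₀ ≅ Li^* K₁` for a perfect complex `K₁`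
on `Y₁`, and then the isomorphism classes of such lifts form a torsor under
`Ext¹_{Y₀}(K₀, K₀ ⊗ᴸ 𝓘)`. Sources read, verbatim:

* The Stacks Project, Deformation Theory. Tag 08KY: "A *thickening* of ringed spaces is a
  morphism `i : (X, 𝒪_X) → (X', 𝒪_{X'})` such that (a) `i` induces a homeomorphism `X → X'`,
  (b) `i♯ : 𝒪_{X'} → i_*𝒪_X` is surjective, and (c) the kernel of `i♯` is a locally nilpotent
  sheaf of ideals. A *first order thickening* … such that `Ker(i♯)` has square zero. […] In
  particular, if `i` is a first order thickening, then `𝓘` is a `𝒪_X`-module." Tag 0DIS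
  ("Deformations of complexes on ringed topoi"; "This material is taken from [Lieblich]"):
  Tag 0DIU "Let `𝒪 → 𝒪₀` be a surjection of sheaves of rings whose kernel is an ideal sheaf `𝓘`
  of square zero. For every object `K₀` in `D⁻(𝒪₀)` there is a canonical map
  `ω(K₀) : K₀ → K₀ ⊗ᴸ_{𝒪₀} 𝓘[2]` in `D(𝒪₀)`" (natural in `K₀`); Tag 0DIW "the following are
  equivalent (1) the class `ω(K₀) ∈ Ext²_{𝒪₀}(K₀, K₀ ⊗_{𝒪₀} 𝓘)` is zero, (2) there exists
  `K ∈ D⁻(𝒪)` with `K ⊗ᴸ_𝒪 𝒪₀ = K₀` in `D(𝒪₀)`"; Tag 0DIZ "A lift of `K₀` is a pair `(K, α₀)`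
  consisting of an object `K` in `D⁻(𝒪)` and an isomorphism `α₀ : K ⊗ᴸ_𝒪 𝒪₀ → K₀` in `D(𝒪₀)`.
  (1) Given a lift `(K, α)` the group of automorphism of the pair is canonically the cokernel of
  a map `Ext⁻¹_{𝒪₀}(K₀, K₀) → Hom_{𝒪₀}(K₀, K₀ ⊗ᴸ_{𝒪₀} 𝓘)`, (2) If there is a lift, then the set
  of isomorphism classes of lifts is principal homogenenous under
  `Ext¹_{𝒪₀}(K₀, K₀ ⊗ᴸ_{𝒪₀} 𝓘)`"; Tag 0DIY, proof: "`Hom_{D(𝒪)}(K, (L ⊗ᴸ_𝒪 𝓘)[1]) =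
  Hom_{D(𝒪₀)}(K₀, (L ⊗ᴸ_𝒪 𝓘)[1]) = Ext¹_{𝒪₀}(K₀, L₀ ⊗ᴸ_{𝒪₀} 𝓘)` by adjunction";
  Tag 0DYR (the ring case) and Tag 08VR (flat modules); Tag 07LU (over a ring, a complex which is
  perfect modulo a nilpotent ideal is perfect).
* M. Lieblich, *Moduli of complexes on a proper morphism* (2006), §3 (p. 8 of arXiv:math/0502198):
  Def. 3.2.1 "A deformation of `E₀` to `X_A` is an object `E ∈ D(X_A)` along with an isomorphism
  `E ⊗ᴸ_A A₀ ⥲ E₀`. An isomorphism of deformations is an isomorphism `E ⥲ E'` which respects the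
  isomorphisms with `E₀`"; Thm. 3.1.1 "There is an element
  `ω(E₀) ∈ Ext²_{X_{A₀}}(E₀, E₀ ⊗ᴸ_{A₀} I)` which vanishes if and only if there is a deformation of
  `E₀` to `X_A`. The set of deformations of `E₀` to `X_A` is a pseudo-torsor under
  `Ext¹_{X_{A₀}}(E₀, E₀ ⊗ᴸ_{A₀} I)`. […] the set of infinitesimal automorphisms of `E` is a torsor
  under `Ext⁰`"; Cor. 3.1.2 "Suppose `J ⊇ I` annihilates `I`, and let `Ā = A/J`,
  `Ē = E₀ ⊗ᴸ_{A₀} Ā`. There is an element `ω(E₀) ∈ Ext²_{X_Ā}(Ē, Ē ⊗ᴸ_Ā I)` which vanishes if and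
  only if there is a deformation of `E₀` to `X_A`. The set of deformations … is a pseudo-torsor
  under `Ext¹_{X_Ā}(Ē, Ē ⊗ᴸ_Ā I)`" ("immediate consequence of the cher à Cartan isomorphisms");
  Lemma 3.2.4 (deformations of relatively perfect complexes are relatively perfect). Setting:
  `X → S` flat of finite presentation, `0 → I → A → A₀ → 0` a square-zero extension of `S`-rings.
* D. Huybrechts, R. P. Thomas, *Deformation-obstruction theory for complexes via Atiyah and
  Kodaira–Spencer classes* (2010), §2.3 "fix `i : X₀ ↪ X`, a closed embedding defined by an ideal
  sheaf `I` of square zero: `I² = 0`. This allows us to consider `I` to be an `𝒪_{X₀}`-module";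
  §3.1 "By a deformation of `E₀` over `X` we mean a perfect complex `E` on `X` whose derived
  restriction `i^*E` is isomorphic to `E₀`"; Cor. 3.4 "There is a deformation `E` of `E₀` if and
  only if `0 = (id_{E₀} ⊗ κ(X₀/X)) ∘ A(E₀) ∈ Ext²_{X₀}(E₀, E₀ ⊗ I)`, in which case the deformations
  form a torsor over `Ext¹_{X₀}(E₀, E₀ ⊗ I)`" (`A` the truncated Atiyah class, `κ` the truncated
  Kodaira–Spencer class); proof of Cor. 3.4: "`ẽ ∈ Ext¹_{X₀}(i^*i_*E₀, E₀ ⊗ I) ≅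
  Ext¹_X(i_*E₀, i_*(E₀ ⊗ I))` is what corresponds to `e` under adjunction".
* L. Illusie, *Complexe cotangent et déformations I* (1971), Ch. IV §3 (déformations de Modules):
  the original source of the obstruction in `Ext²(E₀, E₀ ⊗ᴸ J)` / torsor under `Ext¹` formalism
  (attribution; volume I is not held, statements above are quoted from the three sources read).

## Content and design (D-0014/D-0019: real where Mathlib has the notion, posited objects elsewhere)

REAL (Mathlib's schemes, ideal sheaves and `𝒪`-modules):

* `IsFirstOrderThickening i` — `i` is a closed immersion and `i.ker * i.ker = ⊥`
  (`Scheme.Hom.ker : IdealSheafData`, Tag 08KY); PROVED: `range_eq_univ` / `surjective` (the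
  homeomorphism clause of Tag 08KY is automatic: `Supp 𝓘 = Supp 𝓘² = Supp 0 = Y₁` and the range of
  a closed immersion is `Supp(Ker)`), the instance `Surjective i`, and isomorphisms are (trivial)
  first-order thickenings.
* `structureSheafModule Y = 𝒪_Y` as an object of `Y.Modules`, `structureModuleMap i : 𝒪_{Y₁} ⟶
  i_*𝒪_{Y₀}` (the map `i♯` as a morphism of `𝒪_{Y₁}`-modules), `idealModule i = Ker(i♯)` (the
  ideal sheaf `𝓘` as an `𝒪_{Y₁}`-module, a kernel in the abelian category `Y₁.Modules`) and
  `conormalSheaf i = i^*𝓘` (`= 𝓘/𝓘²`, the conormal sheaf; for a first-order thickening this is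
  "`𝓘` regarded as an `𝒪_{Y₀}`-module", Tag 08KY / Huybrechts–Thomas §2.3).

POSITED (hypothesis structures consumed as PARAMETERS, the tree's idiom for objects Mathlib does
not have — cf. `HodgeTheory.GysinFormalism`, `Motives.BettiCycleData`; the pinned Mathlib has the
abelian category `Y.Modules` with `pullback`/`pushforward`, derived categories and `Abelian.Ext`
of single objects, but no perfect complexes on schemes, no derived pull-back `Li^*` and no derived
tensor product `– ⊗ᴸ 𝓘` of `𝒪`-modules, so neither `D_perf(Y)` nor `Ext²_{Y₀}(K₀, K₀ ⊗ᴸ 𝓘)` can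
be named today):

* `PerfectComplexData` — the carrier: for every scheme `Y` a type `Perf Y` (intended:
  isomorphism classes of perfect objects of `D(𝒪_Y)`) with the derived pull-backs
  `pull i = Li^*`, strictly functorial on isomorphism classes.
* `SquareZeroExtensionObstruction P` — over a carrier `P`, the data and EXACTLY the printed
  properties: the groups `Ext n K I` (intended: `Extⁿ_Y(K, K ⊗ᴸ_{𝒪_Y} I)`, indexed by a REAL
  `𝒪_Y`-module `I : Y.Modules`, covariant in `I`), the type `Lifts i K₀` of isomorphism classes
  of lifts `(K₁, α : Li^*K₁ ≅ K₀)` with its forgetful map to `Perf Y₁` (Tag 0DIZ / Lieblich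
  Def. 3.2.1 / Huybrechts–Thomas §3.1), the obstruction `ob i K₀ ∈ Ext 2 K₀ (conormalSheaf i)`
  with `ob = 0 ↔ Nonempty (Lifts i K₀)` (Tag 0DIW, Thm. 3.1.1, Cor. 3.4), the free and transitive
  action of `Ext 1 K₀ (conormalSheaf i)` on `Lifts i K₀` (Tag 0DIZ (2) "principal homogeneous",
  Thm. 3.1.1 "pseudo-torsor", Cor. 3.4 "torsor"), and the adjunction ("cher à Cartan")
  isomorphism `extRestrict : Extⁿ_Y(K, K ⊗ᴸ j_*I₀) ≃+ Extⁿ_{Y₀}(Lj^*K, Lj^*K ⊗ᴸ I₀)` along a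
  closed immersion `j : Y₀ ⟶ Y` (Lieblich Cor. 3.1.2; Tag 0DIY, proof; Huybrechts–Thomas, proof
  of Cor. 3.4), which is what computes the obstruction groups of a thickening `Y' ⊂ Y''` whose
  ideal is killed by the ideal of a smaller `Y ⊂ Y'` on `Y` itself (the `Y`-adic situation
  `Y ⊂ Y_{m-1} ⊂ Y_m`, ideal `𝓘^m/𝓘^{m+1}`).
* PROVED from the fields: `ob_eq_zero_iff_exists` (`ob = 0 ↔ ∃ K₁, Li^*K₁ = K₀`),
  `exists_pull_eq_of_subsingleton` (`Ext² = 0 ⇒` a lift exists), `liftsEquiv`/`liftsAddTorsor`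
  (a lift trivialises the torsor), `subsingleton_lifts`/`eq_of_pull_eq` (`Ext¹ = 0 ⇒` lifts are
  unique up to isomorphism), `extMapIso`, and the same statements over a base `j : Y ⟶ Y₀`
  (`obOver`, `obOver_eq_zero_iff`, `exists_pull_eq_of_subsingleton_over`, `eq_of_pull_eq_over`):
  the "finite obstruction window" mechanism (vanishing of `Ext²_Y(F₀, F₀ ⊗ᴸ N^{-m})` and
  `Ext¹_Y(F₀, F₀ ⊗ᴸ N^{-m})` for `m ≫ 0` forces existence and uniqueness of all further lifts).

Not here (deliberately): (1) a CONSTRUCTION of the intended instance (Tag 0DIU: `ω(K₀) = d ∘ d`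
on a flat bounded-above resolution; Huybrechts–Thomas: product of truncated Atiyah and
Kodaira–Spencer classes) — a theory, not a lemma, and there is deliberately no named existence
fact `Nonempty (SquareZeroExtensionObstruction P)` (D-0026); (2) naturality of `ob` in `K₀`
(Tag 0DIU) and infinitesimal automorphisms (Tag 0DIZ (1), Thm. 3.1.1 (3)), which need `Perf Y` as a
category rather than a set of isomorphism classes; (3) the SEMIREGULARITY MAP
`σ_q : Ext²_X(F, F) → H^{q+2}(X, Ω^q_X)` of Buchweitz–Flenner (trace of powers of the Atiyah
class) and the theorem that `σ` carries the obstruction to the obstruction against the Chern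
character remaining a Hodge class — printed for deformations OVER AN ARTINIAN BASE (Bloch 1972 for
local complete intersections; Buchweitz–Flenner 2003; Pridham 2024, Theorem p. 2: `X → Spec A`
smooth, `I ⊂ A` square-zero, `B = A/I`, `ℱ` perfect on `X' = X ⊗_A B`: `ch_p(ℱ)` lies in
`F^p H^{2p}(X, Ω•_{X/A})` iff `o(ℱ) ∈ Ext²_{𝒪_{X'}}(ℱ, ℱ ⊗_B I)` maps to zero under
`σ_{p-1} : Ext² → H^{p+1}(X, IΩ^{p-1}_{X/A}) → H^{2p}(X, Ω^{<p}_{X/A})`), not for an embedded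
thickening `Y_{m-1} ⊂ Y_m` inside a fixed variety with twist `N^{-m}`; the map `σ` itself is the
subject of the separate definition request `semiregularityMap` (`Literature/AlgebraicGeometry/
HodgeTheory`), and no twisted/embedded semiregularity statement was found in print.

## References

* [StacksProject] The Stacks Project, Tags 08KY, 0DIS, 0DIU, 0DIW, 0DIY, 0DIZ, 0DYR, 08VR, 07LU.
* [Lieblich2006] M. Lieblich, Moduli of complexes on a proper morphism, J. Algebraic Geom. 15
  (2006), §3: Thm. 3.1.1, Cor. 3.1.2, Def. 3.2.1, Lemma 3.2.4.
* [HuybrechtsThomas2010] D. Huybrechts, R. P. Thomas, Math. Ann. 346 (2010), §2.3, §3.1, Cor. 3.4.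
* [Illusie1971] L. Illusie, Complexe cotangent et déformations I, LNM 239, Ch. IV §3.
* [BuchweitzFlenner2003], [Bloch1972Semiregularity], [Pridham2024], [BlochEsnaultKerz2014CharZero]
  — the semiregularity side, NOT vendored here (see above).
-/

noncomputable section

open CategoryTheory CategoryTheory.Limits AlgebraicGeometry

universe u

namespace Literature.AlgebraicGeometry.Deformation

/-! ### First-order thickenings of schemes (Tag 08KY) -/

section Thickening

variable {Y₀ Y₁ : Scheme.{u}}

/-- A **first-order thickening** of schemes: a closed immersion `i : Y₀ ⟶ Y₁` whose (quasi-coherent)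
kernel ideal sheaf `𝓘 = Ker(i♯ : 𝒪_{Y₁} → i_*𝒪_{Y₀})` has square zero, `𝓘 · 𝓘 = 0` (Mathlib's
`Scheme.Hom.ker : Y₁.IdealSheafData` and its multiplication). The remaining clause of the printed
definition, "`i` induces a homeomorphism", is automatic (`IsFirstOrderThickening.surjective`).
[cite: StacksProject, Tag 08KY] -/
class IsFirstOrderThickening (i : Y₀ ⟶ Y₁) : Prop extends IsClosedImmersion i where
  /-- The kernel ideal sheaf has square zero: `Ker(i♯) · Ker(i♯) = 0`. -/
  ker_mul_ker_eq_bot : i.ker * i.ker = ⊥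

namespace IsFirstOrderThickening

/-- An isomorphism is a (trivial) first-order thickening: its kernel ideal sheaf is `0`.
[cite: StacksProject, Tag 08KY] -/
instance (priority := 100) of_isIso (i : Y₀ ⟶ Y₁) [IsIso i] : IsFirstOrderThickening i where
  ker_mul_ker_eq_bot := by
    rw [Scheme.Hom.ker_eq_bot_of_isIso]
    exact zero_mul (⊥ : Y₁.IdealSheafData)

variable (i : Y₀ ⟶ Y₁) [IsFirstOrderThickening i]

/-- `Ker(i♯)² = 0`. [cite: StacksProject, Tag 08KY] -/
theorem ker_pow_two_eq_bot : i.ker ^ 2 = ⊥ := by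
  rw [pow_two, ker_mul_ker_eq_bot]

/-- The support of the square-zero ideal `Ker(i♯)` is all of `Y₁`
(`Supp 𝓘 = Supp(𝓘 · 𝓘) = Supp 0`). [cite: StacksProject, Tag 08KY] -/
theorem support_ker_eq_top : i.ker.support = ⊤ := by
  have h := congrArg Scheme.IdealSheafData.support (ker_mul_ker_eq_bot (i := i))
  simpa [Scheme.IdealSheafData.support_bot] using h

/-- A first-order thickening is surjective ("`i` induces a homeomorphism `X → X'`": the range of
the closed immersion `i` is closed with closure `Supp Ker(i♯) = Y₁`).
[cite: StacksProject, Tag 08KY] -/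
theorem range_eq_univ : Set.range i = Set.univ := by
  have h := Scheme.Hom.support_ker i
  rw [support_ker_eq_top, (Scheme.Hom.isClosedEmbedding i).isClosed_range.closure_eq] at h
  simpa using h.symm

/-- A first-order thickening is surjective on points. [cite: StacksProject, Tag 08KY] -/
theorem surjective : Function.Surjective i :=
  Set.range_eq_univ.mp (range_eq_univ i)

/-- A first-order thickening is a surjective closed immersion, i.e. a homeomorphism onto `Y₁`
(Mathlib's `Surjective`). [cite: StacksProject, Tag 08KY] -/
instance (priority := 100) toSurjective : Surjective i :=
  ⟨surjective i⟩

end IsFirstOrderThickening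

/-! ### The ideal of a closed immersion as a module, and the conormal sheaf (real) -/

/-- The structure sheaf `𝒪_Y` regarded as an `𝒪_Y`-module (Mathlib's `SheafOfModules.unit`),
an object of the abelian category `Y.Modules`. [folklore] -/
abbrev structureSheafModule (Y : Scheme.{u}) : Y.Modules :=
  SheafOfModules.unit Y.ringCatSheaf

/-- The map `i♯ : 𝒪_{Y₁} ⟶ i_*𝒪_{Y₀}` of a morphism of schemes `i : Y₀ ⟶ Y₁`, as a morphism of
`𝒪_{Y₁}`-modules (Mathlib's `SheafOfModules.unitToPushforwardObjUnit`).
[cite: StacksProject, Tag 08KY] -/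
def structureModuleMap (i : Y₀ ⟶ Y₁) :
    structureSheafModule Y₁ ⟶ (Scheme.Modules.pushforward i).obj (structureSheafModule Y₀) :=
  SheafOfModules.unitToPushforwardObjUnit i.toRingCatSheafHom

/-- On sections over `U ⊆ Y₁`, `structureModuleMap i` is the ring map
`i.app U : Γ(Y₁, U) → Γ(Y₀, i⁻¹U)`. [cite: StacksProject, Tag 08KY] -/
theorem structureModuleMap_val_app_apply (i : Y₀ ⟶ Y₁) (U : Y₁.Opens) (a : Γ(Y₁, U)) :
    (structureModuleMap i).val.app (Opposite.op U) a = i.app U a :=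
  rfl

/-- The **ideal sheaf** `𝓘 = Ker(i♯ : 𝒪_{Y₁} → i_*𝒪_{Y₀})` of a morphism `i : Y₀ ⟶ Y₁` as an
`𝒪_{Y₁}`-module: the kernel, in the abelian category `Y₁.Modules`, of `structureModuleMap i`
("`𝓘 = Ker(i♯)` … a short exact sequence `0 → 𝓘 → 𝒪_{X'} → 𝒪_X → 0` of `𝒪_{X'}`-modules").
[cite: StacksProject, Tag 08KY] -/
abbrev idealModule (i : Y₀ ⟶ Y₁) : Y₁.Modules :=
  kernel (structureModuleMap i)

/-- The inclusion `𝓘 ↪ 𝒪_{Y₁}`. [cite: StacksProject, Tag 08KY] -/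
abbrev idealModuleι (i : Y₀ ⟶ Y₁) : idealModule i ⟶ structureSheafModule Y₁ :=
  kernel.ι (structureModuleMap i)

/-- `𝓘 ↪ 𝒪_{Y₁} → i_*𝒪_{Y₀}` is zero. [cite: StacksProject, Tag 08KY] -/
@[reassoc]
theorem idealModuleι_comp_structureModuleMap (i : Y₀ ⟶ Y₁) :
    idealModuleι i ≫ structureModuleMap i = 0 :=
  kernel.condition _

/-- The **conormal sheaf** `i^*𝓘 = 𝓘 ⊗_{𝒪_{Y₁}} 𝒪_{Y₀} = 𝓘/𝓘²` of `i : Y₀ ⟶ Y₁`, an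
`𝒪_{Y₀}`-module; for a first-order thickening (`𝓘² = 0`) this is "`𝓘` regarded as an
`𝒪_{Y₀}`-module", the coefficient module of the obstruction groups
`Extⁿ_{Y₀}(K₀, K₀ ⊗ᴸ 𝓘)`. [cite: StacksProject, Tag 08KY] [cite: HuybrechtsThomas2010, §2.3] -/
def conormalSheaf (i : Y₀ ⟶ Y₁) : Y₀.Modules :=
  (Scheme.Modules.pullback i).obj (idealModule i)

end Thickening

/-! ### Posited carriers: perfect complexes and derived pull-back -/

/-- **Perfect complexes and derived pull-backs** (posited carrier, D-0019): for every scheme `Y` a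
type `Perf Y` — intended: the isomorphism classes of perfect objects of the derived category
`D(𝒪_Y)` — and for every morphism `i : Y₀ ⟶ Y₁` the derived pull-back `pull i = Li^* : Perf Y₁ →
Perf Y₀`, functorial (strictly, on isomorphism classes): `L(𝟙)^* = id`,
`L(i ≫ j)^* = Li^* ∘ Lj^*`. Consumers take `(P : PerfectComplexData)` as a parameter; the
pinned Mathlib has no perfect complexes on schemes to instantiate it with.
[cite: StacksProject, Tag 0DIS] [cite: HuybrechtsThomas2010, §3.1] -/
structure PerfectComplexData where
  /-- `Perf Y`: (isomorphism classes of) perfect complexes on the scheme `Y`. -/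
  Perf : Scheme.{u} → Type (u + 1)
  /-- `pull i = Li^*`, the derived pull-back of perfect complexes along `i : Y₀ ⟶ Y₁`. -/
  pull : ∀ {Y₀ Y₁ : Scheme.{u}}, (Y₀ ⟶ Y₁) → Perf Y₁ → Perf Y₀
  /-- `L(𝟙_Y)^* K = K`. -/
  pull_id : ∀ (Y : Scheme.{u}) (K : Perf Y), pull (𝟙 Y) K = K
  /-- `L(i ≫ j)^* K = Li^*(Lj^* K)`. -/
  pull_comp : ∀ {Y₀ Y₁ Y₂ : Scheme.{u}} (i : Y₀ ⟶ Y₁) (j : Y₁ ⟶ Y₂) (K : Perf Y₂),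
    pull (i ≫ j) K = pull i (pull j K)

/-! ### The hypothesis structure -/

/-- **Obstruction theory for lifting perfect complexes across first-order thickenings**
(hypothesis structure over a carrier `P : PerfectComplexData`, D-0014/D-0019). Data: the groups
`Ext n K I` (intended: `Extⁿ_Y(K, K ⊗ᴸ_{𝒪_Y} I)` for `K ∈ Perf Y` and a (real) `𝒪_Y`-module `I`),
covariant in `I`; for a first-order thickening `i : Y₀ ⟶ Y₁` with ideal `𝓘` (as `𝒪_{Y₀}`-module:
`conormalSheaf i`) and `K₀ ∈ Perf Y₀`, the type `Lifts i K₀` of isomorphism classes of lifts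
`(K₁, α : Li^*K₁ ≅ K₀)` ("A lift of `K₀` is a pair `(K, α₀)`") with its forgetful map to
`Perf Y₁`, and the obstruction class `ob i K₀ ∈ Ext²_{Y₀}(K₀, K₀ ⊗ᴸ 𝓘)`. Properties, as printed:
`ob i K₀ = 0 ↔` a lift exists (Tag 0DIW; Lieblich Thm. 3.1.1; Huybrechts–Thomas Cor. 3.4, for
perfect complexes); the isomorphism classes of lifts form a pseudo-torsor (a torsor as soon as one
lift exists) under `Ext¹_{Y₀}(K₀, K₀ ⊗ᴸ 𝓘)` (Tag 0DIZ (2); Thm. 3.1.1; Cor. 3.4); and the adjunction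
isomorphism `Extⁿ_Y(K, K ⊗ᴸ j_*I₀) ≅ Extⁿ_{Y₀}(Lj^*K, Lj^*K ⊗ᴸ I₀)` for a closed immersion
`j : Y₀ ⟶ Y` (Lieblich Cor. 3.1.2, "cher à Cartan isomorphisms"; Tag 0DIY, proof). Consumers take
`(T : SquareZeroExtensionObstruction P)` as a parameter; the intended instance (`ω(K₀) = d ∘ d` on a
flat resolution, Tag 0DIU; truncated Atiyah class composed with the Kodaira–Spencer class,
Huybrechts–Thomas) is a construction the tree does not have.
[cite: StacksProject, Tags 0DIW and 0DIZ] [cite: Lieblich2006, Thm. 3.1.1 and Cor. 3.1.2]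
[cite: HuybrechtsThomas2010, Cor. 3.4] -/
structure SquareZeroExtensionObstruction (P : PerfectComplexData.{u}) where
  /-- The obstruction groups `Ext n K I = Extⁿ_Y(K, K ⊗ᴸ_{𝒪_Y} I)` of a perfect complex `K` on `Y`
  with coefficients in an `𝒪_Y`-module `I` (posited). [cite: StacksProject, Tag 0DIW] -/
  Ext : ℕ → ∀ {Y : Scheme.{u}}, P.Perf Y → Y.Modules → Type u
  /-- `Extⁿ_Y(K, K ⊗ᴸ I)` is an abelian group. -/
  [addCommGroup : ∀ (n : ℕ) {Y : Scheme.{u}} (K : P.Perf Y) (I : Y.Modules),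
    AddCommGroup (Ext n K I)]
  /-- Covariant functoriality of `Extⁿ_Y(K, K ⊗ᴸ I)` in the coefficient module `I`. -/
  extMap : ∀ (n : ℕ) {Y : Scheme.{u}} (K : P.Perf Y) {I I' : Y.Modules},
    (I ⟶ I') → (Ext n K I →+ Ext n K I')
  /-- `Extⁿ(K, K ⊗ᴸ 𝟙_I) = id`. -/
  extMap_id : ∀ (n : ℕ) {Y : Scheme.{u}} (K : P.Perf Y) (I : Y.Modules),
    extMap n K (𝟙 I) = AddMonoidHom.id _
  /-- `Extⁿ(K, K ⊗ᴸ (f ≫ g)) = Extⁿ(K, K ⊗ᴸ g) ∘ Extⁿ(K, K ⊗ᴸ f)`. -/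
  extMap_comp : ∀ (n : ℕ) {Y : Scheme.{u}} (K : P.Perf Y) {I I' I'' : Y.Modules}
    (f : I ⟶ I') (g : I' ⟶ I''), extMap n K (f ≫ g) = (extMap n K g).comp (extMap n K f)
  /-- **Adjunction isomorphism** along a closed immersion `j : Y₀ ⟶ Y`, for an `𝒪_{Y₀}`-module
  `I₀`: `Extⁿ_Y(K, K ⊗ᴸ_{𝒪_Y} j_*I₀) ≅ Extⁿ_{Y₀}(Lj^*K, Lj^*K ⊗ᴸ_{𝒪_{Y₀}} I₀)`
  (`K ⊗ᴸ j_*I₀ = j_*(Lj^*K ⊗ᴸ I₀)` and `Hom_{D(𝒪)}(K, j_*M) = Hom_{D(𝒪₀)}(Lj^*K, M)`; this is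
  how the obstruction groups of a thickening whose ideal is killed by the ideal of `Y₀` are
  computed on `Y₀`). [cite: Lieblich2006, Cor. 3.1.2] [cite: StacksProject, Tag 0DIY (proof)] -/
  extRestrict : ∀ (n : ℕ) {Y₀ Y : Scheme.{u}} (j : Y₀ ⟶ Y) [IsClosedImmersion j] (K : P.Perf Y)
    (I₀ : Y₀.Modules), Ext n K ((Scheme.Modules.pushforward j).obj I₀) ≃+ Ext n (P.pull j K) I₀
  /-- `Lifts i K₀`: the isomorphism classes of **lifts** `(K₁, α : Li^*K₁ ≅ K₀)` of `K₀ ∈ Perf Y₀`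
  across the first-order thickening `i : Y₀ ⟶ Y₁` ("A lift of `K₀` is a pair `(K, α₀)` consisting
  of an object `K` in `D⁻(𝒪)` and an isomorphism `α₀ : K ⊗ᴸ_𝒪 𝒪₀ → K₀`"; a lift of a perfect
  complex is perfect, Tag 07LU / Lieblich Lemma 3.2.4) (posited).
  [cite: StacksProject, Tag 0DIZ] [cite: Lieblich2006, Def. 3.2.1] -/
  Lifts : ∀ {Y₀ Y₁ : Scheme.{u}} (i : Y₀ ⟶ Y₁) [IsFirstOrderThickening i], P.Perf Y₀ → Type (u + 1)
  /-- The underlying perfect complex `K₁ ∈ Perf Y₁` of a lift `(K₁, α)`. -/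
  liftObj : ∀ {Y₀ Y₁ : Scheme.{u}} {i : Y₀ ⟶ Y₁} [IsFirstOrderThickening i] {K₀ : P.Perf Y₀},
    Lifts i K₀ → P.Perf Y₁
  /-- A lift `(K₁, α)` of `K₀` has `Li^*K₁ ≅ K₀`. [cite: StacksProject, Tag 0DIZ] -/
  pull_liftObj : ∀ {Y₀ Y₁ : Scheme.{u}} {i : Y₀ ⟶ Y₁} [IsFirstOrderThickening i] {K₀ : P.Perf Y₀}
    (ℓ : Lifts i K₀), P.pull i (liftObj ℓ) = K₀
  /-- Every `K₁ ∈ Perf Y₁` with `Li^*K₁ ≅ K₀` underlies a lift (choose an `α`).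
  [cite: StacksProject, Tag 0DIZ] -/
  exists_liftObj_eq : ∀ {Y₀ Y₁ : Scheme.{u}} {i : Y₀ ⟶ Y₁} [IsFirstOrderThickening i]
    {K₀ : P.Perf Y₀} (K₁ : P.Perf Y₁), P.pull i K₁ = K₀ → ∃ ℓ : Lifts i K₀, liftObj ℓ = K₁
  /-- The **obstruction class** `ob i K₀ = ω(K₀) ∈ Ext²_{Y₀}(K₀, K₀ ⊗ᴸ 𝓘)` of `K₀ ∈ Perf Y₀` with
  respect to the first-order thickening `i : Y₀ ⟶ Y₁` with ideal `𝓘` (`conormalSheaf i`).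
  [cite: StacksProject, Tag 0DIU] [cite: HuybrechtsThomas2010, Cor. 3.4] -/
  ob : ∀ {Y₀ Y₁ : Scheme.{u}} (i : Y₀ ⟶ Y₁) [IsFirstOrderThickening i] (K₀ : P.Perf Y₀),
    Ext 2 K₀ (conormalSheaf i)
  /-- "`ω(K₀) = 0` if and only if there exists `K ∈ D⁻(𝒪)` with `K ⊗ᴸ_𝒪 𝒪₀ = K₀`"; "there is an
  element `ω(E₀) ∈ Ext²(E₀, E₀ ⊗ᴸ I)` which vanishes if and only if there is a deformation of `E₀`".
  [cite: StacksProject, Tag 0DIW] [cite: Lieblich2006, Thm. 3.1.1]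
  [cite: HuybrechtsThomas2010, Cor. 3.4] -/
  ob_eq_zero_iff : ∀ {Y₀ Y₁ : Scheme.{u}} (i : Y₀ ⟶ Y₁) [IsFirstOrderThickening i]
    (K₀ : P.Perf Y₀), ob i K₀ = 0 ↔ Nonempty (Lifts i K₀)
  /-- The action of `Ext¹_{Y₀}(K₀, K₀ ⊗ᴸ 𝓘)` on the isomorphism classes of lifts.
  [cite: StacksProject, Tag 0DIZ] -/
  [addAction : ∀ {Y₀ Y₁ : Scheme.{u}} (i : Y₀ ⟶ Y₁) [IsFirstOrderThickening i] (K₀ : P.Perf Y₀),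
    AddAction (Ext 1 K₀ (conormalSheaf i)) (Lifts i K₀)]
  /-- The action is **free** ("principal homogeneous" / "pseudo-torsor": a stabiliser is trivial).
  [cite: StacksProject, Tag 0DIZ] [cite: Lieblich2006, Thm. 3.1.1] -/
  eq_zero_of_vadd_eq : ∀ {Y₀ Y₁ : Scheme.{u}} (i : Y₀ ⟶ Y₁) [IsFirstOrderThickening i]
    (K₀ : P.Perf Y₀) (x : Ext 1 K₀ (conormalSheaf i)) (ℓ : Lifts i K₀), x +ᵥ ℓ = ℓ → x = 0
  /-- The action is **transitive** ("if there is a lift, then the set of isomorphism classes of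
  lifts is principal homogeneous under `Ext¹_{𝒪₀}(K₀, K₀ ⊗ᴸ_{𝒪₀} 𝓘)`"; "the deformations form a
  torsor over `Ext¹_{X₀}(E₀, E₀ ⊗ I)`").
  [cite: StacksProject, Tag 0DIZ] [cite: HuybrechtsThomas2010, Cor. 3.4] -/
  exists_vadd_eq : ∀ {Y₀ Y₁ : Scheme.{u}} (i : Y₀ ⟶ Y₁) [IsFirstOrderThickening i]
    (K₀ : P.Perf Y₀) (ℓ ℓ' : Lifts i K₀), ∃ x : Ext 1 K₀ (conormalSheaf i), x +ᵥ ℓ = ℓ'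

namespace SquareZeroExtensionObstruction

variable {P : PerfectComplexData.{u}} (T : SquareZeroExtensionObstruction P)

/-- The obstruction groups `Extⁿ_Y(K, K ⊗ᴸ I)` of a theory `T` are abelian groups (the field
`addCommGroup`, re-exported as an instance on the new types `T.Ext n K I`).
[cite: StacksProject, Tag 0DIW] -/
instance instAddCommGroupExt (n : ℕ) {Y : Scheme.{u}} (K : P.Perf Y) (I : Y.Modules) :
    AddCommGroup (T.Ext n K I) :=
  T.addCommGroup n K I

/-- `Ext¹_{Y₀}(K₀, K₀ ⊗ᴸ 𝓘)` acts on the isomorphism classes of lifts (the field `addAction`,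
re-exported as an instance on the new types `T.Lifts i K₀`). [cite: StacksProject, Tag 0DIZ] -/
instance instAddActionLifts {Y₀ Y₁ : Scheme.{u}} (i : Y₀ ⟶ Y₁) [IsFirstOrderThickening i]
    (K₀ : P.Perf Y₀) : AddAction (T.Ext 1 K₀ (conormalSheaf i)) (T.Lifts i K₀) :=
  T.addAction i K₀

/-- `Extⁿ_Y(K, K ⊗ᴸ –)` carries isomorphisms of coefficient modules to isomorphisms of groups
(from `extMap_id`, `extMap_comp`). [cite: StacksProject, Tag 0DIW] -/
def extMapIso (n : ℕ) {Y : Scheme.{u}} (K : P.Perf Y) {I I' : Y.Modules} (e : I ≅ I') :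
    T.Ext n K I ≃+ T.Ext n K I' :=
  (T.extMap n K e.hom).toAddEquiv (T.extMap n K e.inv)
    (by rw [← T.extMap_comp, e.hom_inv_id, T.extMap_id])
    (by rw [← T.extMap_comp, e.inv_hom_id, T.extMap_id])

/-- `extMapIso e` is `extMap e.hom`. [cite: StacksProject, Tag 0DIW] -/
@[simp]
theorem extMapIso_apply (n : ℕ) {Y : Scheme.{u}} (K : P.Perf Y) {I I' : Y.Modules} (e : I ≅ I')
    (x : T.Ext n K I) : T.extMapIso n K e x = T.extMap n K e.hom x :=
  rfl

section Lifting

variable {Y₀ Y₁ : Scheme.{u}} (i : Y₀ ⟶ Y₁) [IsFirstOrderThickening i] (K₀ : P.Perf Y₀)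

/-- A lift exists iff some perfect `K₁` on `Y₁` has `Li^*K₁ ≅ K₀`.
[cite: StacksProject, Tag 0DIZ] -/
theorem nonempty_lifts_iff :
    Nonempty (T.Lifts i K₀) ↔ ∃ K₁ : P.Perf Y₁, P.pull i K₁ = K₀ := by
  constructor
  · rintro ⟨ℓ⟩
    exact ⟨T.liftObj ℓ, T.pull_liftObj ℓ⟩
  · rintro ⟨K₁, h⟩
    obtain ⟨ℓ, -⟩ := T.exists_liftObj_eq K₁ h
    exact ⟨ℓ⟩

/-- **Tag 0DIW in terms of objects**: `ob i K₀ = 0 ↔ ∃ K₁ ∈ Perf Y₁, Li^*K₁ ≅ K₀`.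
[cite: StacksProject, Tag 0DIW] [cite: HuybrechtsThomas2010, Cor. 3.4] -/
theorem ob_eq_zero_iff_exists :
    T.ob i K₀ = 0 ↔ ∃ K₁ : P.Perf Y₁, P.pull i K₁ = K₀ :=
  (T.ob_eq_zero_iff i K₀).trans (T.nonempty_lifts_iff i K₀)

/-- If the obstruction group `Ext²_{Y₀}(K₀, K₀ ⊗ᴸ 𝓘)` vanishes, `K₀` lifts across `i`
(the mechanism of every "unobstructedness by vanishing of `Ext²`" argument).
[cite: StacksProject, Tag 0DIW] -/
theorem exists_pull_eq_of_subsingleton [Subsingleton (T.Ext 2 K₀ (conormalSheaf i))] :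
    ∃ K₁ : P.Perf Y₁, P.pull i K₁ = K₀ :=
  (T.ob_eq_zero_iff_exists i K₀).mp (Subsingleton.elim _ _)

/-- Freeness: `x ↦ x +ᵥ ℓ` is injective for every lift `ℓ`. [cite: StacksProject, Tag 0DIZ] -/
theorem vadd_injective (ℓ : T.Lifts i K₀) :
    Function.Injective fun x : T.Ext 1 K₀ (conormalSheaf i) => x +ᵥ ℓ := by
  intro x y h
  have h' : (-y + x) +ᵥ ℓ = ℓ := by
    dsimp only at h
    rw [add_vadd, h, neg_vadd_vadd]
  have := T.eq_zero_of_vadd_eq i K₀ (-y + x) ℓ h'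
  exact (neg_add_eq_zero.mp this).symm

/-- **A lift trivialises the torsor**: `x ↦ x +ᵥ ℓ` is a bijection
`Ext¹_{Y₀}(K₀, K₀ ⊗ᴸ 𝓘) ≃ Lifts i K₀` ("principal homogeneous").
[cite: StacksProject, Tag 0DIZ] [cite: HuybrechtsThomas2010, Cor. 3.4] -/
def liftsEquiv (ℓ : T.Lifts i K₀) : T.Ext 1 K₀ (conormalSheaf i) ≃ T.Lifts i K₀ :=
  Equiv.ofBijective (fun x => x +ᵥ ℓ)
    ⟨T.vadd_injective i K₀ ℓ, fun ℓ' => T.exists_vadd_eq i K₀ ℓ ℓ'⟩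

/-- `liftsEquiv ℓ x = x +ᵥ ℓ`. [cite: StacksProject, Tag 0DIZ] -/
@[simp]
theorem liftsEquiv_apply (ℓ : T.Lifts i K₀) (x : T.Ext 1 K₀ (conormalSheaf i)) :
    T.liftsEquiv i K₀ ℓ x = x +ᵥ ℓ :=
  rfl

/-- When a lift exists, the isomorphism classes of lifts form a **torsor** (Mathlib `AddTorsor`)
under `Ext¹_{Y₀}(K₀, K₀ ⊗ᴸ 𝓘)`, with `ℓ -ᵥ ℓ'` the unique `x` with `x +ᵥ ℓ' = ℓ`.
[cite: StacksProject, Tag 0DIZ] [cite: HuybrechtsThomas2010, Cor. 3.4] -/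
@[reducible]
def liftsAddTorsor [Nonempty (T.Lifts i K₀)] :
    AddTorsor (T.Ext 1 K₀ (conormalSheaf i)) (T.Lifts i K₀) where
  vsub ℓ ℓ' := Classical.choose (T.exists_vadd_eq i K₀ ℓ' ℓ)
  vsub_vadd' ℓ ℓ' := Classical.choose_spec (T.exists_vadd_eq i K₀ ℓ' ℓ)
  vadd_vsub' x ℓ :=
    T.vadd_injective i K₀ ℓ (Classical.choose_spec (T.exists_vadd_eq i K₀ ℓ (x +ᵥ ℓ)))

/-- If `Ext¹_{Y₀}(K₀, K₀ ⊗ᴸ 𝓘) = 0` there is at most one lift up to isomorphism.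
[cite: StacksProject, Tag 0DIZ] -/
theorem subsingleton_lifts [Subsingleton (T.Ext 1 K₀ (conormalSheaf i))] :
    Subsingleton (T.Lifts i K₀) := by
  constructor
  intro ℓ ℓ'
  obtain ⟨x, rfl⟩ := T.exists_vadd_eq i K₀ ℓ ℓ'
  rw [Subsingleton.elim x 0, zero_vadd]

/-- If `Ext¹_{Y₀}(K₀, K₀ ⊗ᴸ 𝓘) = 0`, any two perfect complexes on `Y₁` restricting to `K₀` are
isomorphic (uniqueness of lifts; the mechanism of formal rigidity beyond an obstruction window).
[cite: StacksProject, Tag 0DIZ] -/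
theorem eq_of_pull_eq [Subsingleton (T.Ext 1 K₀ (conormalSheaf i))] {K₁ K₁' : P.Perf Y₁}
    (h : P.pull i K₁ = K₀) (h' : P.pull i K₁' = K₀) : K₁ = K₁' := by
  obtain ⟨ℓ, rfl⟩ := T.exists_liftObj_eq K₁ h
  obtain ⟨ℓ', rfl⟩ := T.exists_liftObj_eq K₁' h'
  have := T.subsingleton_lifts i K₀
  rw [Subsingleton.elim ℓ ℓ']

end Lifting

/-! ### The obstruction computed on a smaller closed subscheme (Lieblich Cor. 3.1.2) -/

section Over

variable {Y Y₀ Y₁ : Scheme.{u}} (j : Y ⟶ Y₀) [IsClosedImmersion j] (i : Y₀ ⟶ Y₁)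
  [IsFirstOrderThickening i] (K₀ : P.Perf Y₀) (I : Y.Modules)

/-- **The obstruction class over a base.** If the ideal `𝓘` of the first-order thickening
`i : Y₀ ⟶ Y₁` is (as an `𝒪_{Y₀}`-module) the push-forward `j_*I` of an `𝒪_Y`-module `I` along a
closed immersion `j : Y ⟶ Y₀` (i.e. `𝓘` is killed by the ideal of `Y` — "suppose `J ⊇ I`
annihilates `I`"), the obstruction class of `K₀` is the element
`obOver ∈ Ext²_Y(Lj^*K₀, Lj^*K₀ ⊗ᴸ I)` obtained through the adjunction isomorphism `extRestrict`
(the `Y`-adic situation `Y ⊂ Y_{m-1} ⊂ Y_m`: `ob_m ∈ Ext²_Y(F₀, F₀ ⊗ᴸ 𝓘^m/𝓘^{m+1})`).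
[cite: Lieblich2006, Cor. 3.1.2] -/
def obOver (e : conormalSheaf i ≅ (Scheme.Modules.pushforward j).obj I) :
    T.Ext 2 (P.pull j K₀) I :=
  T.extRestrict 2 j K₀ I (T.extMapIso 2 K₀ e (T.ob i K₀))

/-- **Lieblich Cor. 3.1.2, obstruction half**: `obOver = 0 ↔` a lift of `K₀` across `i` exists.
[cite: Lieblich2006, Cor. 3.1.2] [cite: StacksProject, Tag 0DIW] -/
theorem obOver_eq_zero_iff (e : conormalSheaf i ≅ (Scheme.Modules.pushforward j).obj I) :
    T.obOver j i K₀ I e = 0 ↔ ∃ K₁ : P.Perf Y₁, P.pull i K₁ = K₀ := by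
  rw [obOver, map_eq_zero_iff _ (AddEquiv.injective _), map_eq_zero_iff _ (AddEquiv.injective _),
    ob_eq_zero_iff_exists]

/-- **Unobstructedness from the base**: if `Ext²_Y(Lj^*K₀, Lj^*K₀ ⊗ᴸ I) = 0` then `K₀` lifts
across `i` (e.g. `Ext²_Y(F₀, F₀ ⊗ᴸ N^{-m}) = 0` for `m ≫ 0`: the finite obstruction window).
[cite: Lieblich2006, Cor. 3.1.2] [cite: StacksProject, Tag 0DIW] -/
theorem exists_pull_eq_of_subsingleton_over [Subsingleton (T.Ext 2 (P.pull j K₀) I)]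
    (e : conormalSheaf i ≅ (Scheme.Modules.pushforward j).obj I) :
    ∃ K₁ : P.Perf Y₁, P.pull i K₁ = K₀ :=
  (T.obOver_eq_zero_iff j i K₀ I e).mp (Subsingleton.elim _ _)

/-- **Rigidity from the base**: if `Ext¹_Y(Lj^*K₀, Lj^*K₀ ⊗ᴸ I) = 0` then any two perfect
complexes on `Y₁` restricting to `K₀` are isomorphic ("the set of deformations … is a
pseudo-torsor under `Ext¹_{X_Ā}(Ē, Ē ⊗ᴸ_Ā I)`").
[cite: Lieblich2006, Cor. 3.1.2] [cite: StacksProject, Tag 0DIZ] -/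
theorem eq_of_pull_eq_over [Subsingleton (T.Ext 1 (P.pull j K₀) I)]
    (e : conormalSheaf i ≅ (Scheme.Modules.pushforward j).obj I) {K₁ K₁' : P.Perf Y₁}
    (h : P.pull i K₁ = K₀) (h' : P.pull i K₁' = K₀) : K₁ = K₁' := by
  haveI : Subsingleton (T.Ext 1 K₀ (conormalSheaf i)) :=
    ((T.extMapIso 1 K₀ e).trans (T.extRestrict 1 j K₀ I)).toEquiv.subsingleton
  exact T.eq_of_pull_eq i K₀ h h'

end Over

end SquareZeroExtensionObstruction

end Literature.AlgebraicGeometry.Deformation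

end
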